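import Literature.Computability.AlgebraicComplexity.DIP20Prop71Proofs
import Literature.Computability.AlgebraicComplexity.DIP20Prop51Certificates47X02
import Literature.Computability.AlgebraicComplexity.DIP20Prop51Certificates47X11
import HarnessLib

/-!
# No equations for the Chow variety `Ch_7` in degree `≤ 5` (Hadamard 1897 · McKay 2008 ·
# Müller–Neunhöffer 2005 · Cheung–Ikenmeyer–Mkrtchyan 2017), and its consequence for
# Dörfler–Ikenmeyer–Panova 2020 Prop. 5.1, conjunct 2, in inner degree `d ≤ 5`

Topic `Literature/Computability/AlgebraicComplexity` (cell `val-lit`, unit val-lit-t16 g6; companion of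
`DIP20MultiplicityObstructions.lean`, named fact `DIP20_prop_5_1`, and of the kernel plethysm values
`DIP20Prop71Values*.lean` / `DIP20Prop71Proofs.lean`). ONE new named fact, typed OPEN BY DESIGN (its printed
proof is a computer calculation), and theorems proved from it; no new definition of content.

## The printed chain

* (H) J. Hadamard, *Mémoire sur l'élimination*, Acta Math. 20 (1897): the degree-`d` equations of the Chow
  variety of products of `n` linear forms are exactly the kernel of the Hermite–Hadamard–Howe map
  `h_{d,n} : S^d(S^n V) → S^n(S^d V)` — `ker h_{d,n} = I_d(Ch_n(V^*))`. Printed with proof as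
  Landsberg 2017, Thm. 9.1.1.4 (held text pp. 259–260); Cheung–Ikenmeyer–Mkrtchyan 2017, Rem. 6. (In the tree
  in substance: `chowPullback`, `plethysmRestitution`, `orbitMultiplicity_add_finrank_inf_eq_plethysmCoeff`,
  files `ChowPullback.lean`, `ChowPlethysmBridge.lean`, `DIP20ChowUpperBoundProofs.lean`.)
* (M) T. McKay, *On plethysm conjectures of Stanley and Foulkes*, J. Algebra 319 (2008), Thm. 8.1
  (= Cheung–Ikenmeyer–Mkrtchyan 2017, Thm. 2; = Landsberg 2017, Thm. 9.1.2.9 [BL89, McK08, Ike15], proof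
  outlined in §9.3.2): "If `Ψ_{a,b-1}` is injective, then `Ψ_{a,c}` is injective for all `c ≥ b`."
* (I3) Hadamard 1899: `h_{3,3}` is an isomorphism (Landsberg 2017, Thm. 9.1.2.6, with proof).
  (I4) Müller–Neunhöffer 2005: `h_{4,4}` is an isomorphism — a COMPUTER calculation (Landsberg 2017,
  Thm. 9.1.2.10; CIM 2017 p. 3 "[MN:05] calculate that `Ψ_{4×4}` is injective").
  (I5) Cheung–Ikenmeyer–Mkrtchyan 2017, Thm. 5(a): `Ψ_{5,6}` is injective — a COMPUTER calculation
  (§6: "the computation for `ker Ψ_{5,6}` ran for approximately 2 weeks"); p. 3: "There are no equations for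
  `Ch_6` up to degree 5". (NB `Ψ_{5,5}` is NOT injective, Müller–Neunhöffer 2005; its kernel, CIM 2017
  Thm. 5(b), contains the four-row types `(14,7,2,2)` and `(9,7,6,3)`.)

Hence for `n = 7`: `h_{d,7}` is injective for every `d ≤ 5`, i.e. `I_d(Ch_7(V)) = 0` for `d ≤ 5` and every
`V` (the map is functorial in `V`, so injectivity for `dim V ≥ 5`, where all types of `S^d(S^7 V)`, `d ≤ 5`,
live, restricts to `V = ℂ⁴`), i.e. `ℂ[Ch_4^7]_d = ℂ[Sym^7 ℂ⁴]_d` and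
`mult_μ(ℂ[Ch_4^7]_d) = a_μ(d[7])` for every `4`-row weight of degree `d ≤ 5`. In the numerical rendering of
`DIP20MultiplicityObstructions.lean` (`coordRingMultiplicity = plethysmCoeff − dim(HWV_χ ∩ I(Z))`, degree
`d = |μ|/7` pinned by the weight `rowDual μ`) this is the named fact `hadamardHowe_chow47_le_five` below,
stated for all row vectors `μ` with `|μ| ≤ 35` (for `|μ|` not a multiple of `7`, or `μ` not a partition,
both sides concern an empty highest-weight space and the printed `I_d = 0` covers them vacuously).

## Consequence (PROVED here from the fact): DIP 2020 Prop. 5.1, conjunct 2, for `d ≤ 5`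

J. Dörfler, C. Ikenmeyer, G. Panova, SIAM J. Appl. Algebra Geom. 4 (2020) = arXiv:1901.04576, Prop. 5.1:
"for all `μ ∈ X` we have `mult_μ(ℂ[Ch_4^7]) > 0`" (`X` = the 948 rows `dipGeneratorRows47` of Prop. 7.1). For
the `395` rows of `X` with `|μ| ≤ 35` (inner degree `d ≤ 5`; `rows47` indices `0–394`) the positivity of
`a_μ(d[7])` is a KERNEL VALUE already in the tree (`dipGenerators47_plethysmCoeff_pos`, val-lit-p4/t07's
packed dynamic programme for DIP (4.3)–(4.4)), so conjunct 2 holds for them CONDITIONALLY on the fact: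
`coordRingMultiplicity_chowSet47_pos_of_sum_le`. DIP do not argue this way (arXiv p. 7 uses Hermite
reciprocity for two-row `μ` only and the computer for the rest); of these `395` rows, `137` also carry an
unconditional kernel certificate on `Ch_4^7` (files `DIP20Prop51Certificates47*.lean`), the other `258` —
all `224` rows of degree `5` among them — so far only this conditional one.

VACUITY GUARD (proved, `hadamardHowe_chow47_le_five_guard`): two instances of the fact's conclusion that the
tree already decides — the rows `(10,10,1,0)` (`d = 3`) and `(10,6,6,6)` (`d = 4`, four rows) of `X` have
`a_μ(d[7]) = 1` (kernel values, `DIP20Prop71ValuesA1.lean`) and a kernel certificate on `Ch_4^7`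
(`DIP20Prop51Certificates47X02.lean`, `…47X11.lean`, val-lit-x2), so `1 ≤ mult_μ ≤ a_μ = 1` and
`mult_μ = a_μ` holds there unconditionally.

Cell ruling (val-lit lead-bip g6, RULINGS batch #14 (2), 2026-08-27, after lit g8's vet): +1 typed-open named
fact BY DESIGN, class computer/R1 (precedent `IK2020_thm_9_1_orbitFunctions`); it does not replace certificate
filing (every feasible row of degree `≤ 5` is still kernel-certified; certificates are unconditional and
preferred), and `DIP20_prop_5_1_right_of_hadamardHowe_of_ge_six` is booked as a CONDITIONAL second route to
conjunct 2, not as residue progress.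

HONEST FRAMING. (I4) and (I5) are published computer calculations, the same epistemic class as DIP's own
verification of Prop. 5.1; the fact below is therefore typed OPEN BY DESIGN and nothing in this file is a
kernel certificate for a row of `X`. Toy model `Ch_4^7` (Chow variety versus power sums): nothing here bears
on permanent versus determinant; VP ≠ VNP is not proved.

## References

* [CheungIkenmeyerMkrtchyan2017] M.-W. Cheung, C. Ikenmeyer, S. Mkrtchyan, *Symmetrizing tableaux and the 5th
  case of the Foulkes conjecture*, J. Symb. Comput. 80 (2017) 833–843 = arXiv:1509.03944, Thm. 2, Thm. 5, Rem. 6.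
* [MullerNeunhoffer2005] J. Müller, M. Neunhöffer, *Some computations regarding Foulkes' conjecture*,
  Exp. Math. 14 (2005) 277–283.
* [McKay2008] T. McKay, *On plethysm conjectures of Stanley and Foulkes*, J. Algebra 319 (2008) 2050–2071, Thm. 8.1.
* [Landsberg2017] J. M. Landsberg, *Geometry and Complexity Theory*, CUP 2017, §9.1 (Thms. 9.1.1.4, 9.1.2.6,
  9.1.2.9, 9.1.2.10, 9.1.2.11, Prop. 9.1.2.13).
* [DorflerIkenmeyerPanova2020] Prop. 5.1, Prop. 7.1 (arXiv pp. 12, 16).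

## Mathlib and tree

Tree: `coordRingMultiplicity`, `chowSet`, `plethysmCoeff`, `rowDual`, `dipGenerators47`, `dipGeneratorRows47`
(`DIP20MultiplicityObstructions.lean`); `dipGenerators47_plethysmCoeff_pos`, `quadRow`,
`quadRow_mem_dipGenerators47` (`DIP20Prop71Proofs.lean`, `DIP20PlethysmSemigroupGenerators47Cert.lean`);
`coordRingMultiplicity_le_plethysmCoeff`; the guard's kernel inputs `plethysmCoeff_fin_four_rowDual_10_10_1_0_seven`,
`plethysmCoeff_fin_four_rowDual_10_6_6_6_seven` (`DIP20Prop71ValuesA1.lean`) and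
`TableauEval.coordRingMultiplicity_chowSet_rowDual_10_10_1_0_seven_pos` / `…_10_6_6_6_seven_pos` (`DIP20Prop51Certificates47X02/X11.lean`).
-/

namespace Literature.Computability.AlgebraicComplexity

open scoped BigOperators
open _root_.Literature.NumberTheory.DiophantineGeometry

/-- **No equations for `Ch_7` in degree `≤ 5`, numerically: `mult_μ(ℂ[Ch_4^7]_d) = a_μ(d[7])` for every
`4`-row weight `μ^*` of degree `d = |μ|/7 ≤ 5`** — a RENDERED CONSEQUENCE of [CIM17 Thm. 5(a), Thm. 2; MN05;
Had99; Had97], typed OPEN BY DESIGN (its printed proof is a computer calculation). Verbatim sources: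
Cheung–Ikenmeyer–Mkrtchyan 2017, Thm. 5(a) (arXiv:1509.03944 p. 3, held text p0003.txt:L73–75): "(a) `Ψ_{5,6}` is
injective" (computer: §6, p0010.txt:L18 "the computation for `ker Ψ_{5,6}` ran for approximately 2 weeks";
interpretation p0003.txt:L122 "There are no equations for `Ch_6` up to degree 5"); Thm. 2 [McK:08]
(p0003.txt:L57–58): "If `Ψ_{a,(b-1)}` is injective, then `Ψ_{a,c}` is injective for all `c ≥ b`" (= McKay 2008
Thm. 8.1 = Landsberg 2017 Thm. 9.1.2.9 [BL89, McK08, Ike15], p0261:L11, a human theorem, proof outlined §9.3);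
Rem. 6 (p0003.txt:L109–112): "The kernel of `Ψ_{a,b}` is the homogeneous degree `a` part of the vanishing ideal
of `Ch_b`, as was shown by Hadamard" (= Landsberg Thm. 9.1.1.4, p0259:L29, with proof); Landsberg 2017
Thm. 9.1.2.6 (Hadamard 1899, p0260:L19): "`h_{3,3}` … is an isomorphism"; Thm. 9.1.2.10 [MN05] (p0261:L15, "shown
by a computer calculation"): "The map `h_{4,4}` is an isomorphism". Chain: `h_{d,7}` injective for `d = 5`
(Thm. 5(a) + Thm. 2), `d = 4` (9.1.2.10 + Thm. 2), `d = 3` (9.1.2.6 + Thm. 2), `d ≤ 2` (the types of `S^d(S^n V)` have at most `d ≤ 2` rows, where Hermite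
reciprocity, Landsberg Thm. 9.1.2.5, makes `h_{d,n}` an isomorphism), so
`I_d(Ch_7(V)) = ker h_{d,7} = 0` for `d ≤ 5`; the sources work with `dim V` large, and the statement for
`V = ℂ⁴` (types with `ℓ(μ) ≤ 4`) follows by the standard polynomial-functor restriction `V' ⊆ V`
(`S^d(S^7 V') ⊆ S^d(S^7 V)` compatibly with `h`). In the numerical rendering of the tree
(`coordRingMultiplicity = plethysmCoeff − dim(HWV ∩ I)`, degree pinned by the weight) this reads as below, for all
row vectors with `|μ| ≤ 35`. Sharp to `n ≥ 6`: `Ψ_{5,5}` is NOT injective (Landsberg Thm. 9.1.2.11 [MN05];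
kernel = CIM17 Thm. 5(b) ∋ `(14,7,2,2)`, `(9,7,6,3)`).
[cite: CheungIkenmeyerMkrtchyan2017, Thm. 5(a), Thm. 2 and Rem. 6 (arXiv:1509.03944 p. 3; held paper-arxiv-1509.03944 p0003.txt:L57–58, L73–75, L109–112)]
[cite: Landsberg2017, Thms. 9.1.1.4, 9.1.2.6, 9.1.2.9, 9.1.2.10 (§9.1; held book text p0259:L29, p0260:L19, p0261:L11, L15)]
[cite: MullerNeunhoffer2005, via Landsberg2017 Thm. 9.1.2.10] [cite: McKay2008, Thm. 8.1] -/
def hadamardHowe_chow47_le_five : Prop :=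
  ∀ μ : Fin 4 → ℕ, (∑ i, μ i) ≤ 35 →
    coordRingMultiplicity ℂ (chowSet ℂ 4 7) 7 (rowDual μ) = plethysmCoeff ℂ (Fin 4) 7 (rowDual μ)

/-- **Vacuity guard for `hadamardHowe_chow47_le_five`**: two instances of its conclusion hold
unconditionally in the tree — for the rows `(10,10,1,0)` (`d = 3`) and `(10,6,6,6)` (`d = 4`) of `X`,
`mult_μ(ℂ[Ch_4^7]_d) = a_μ(d[7])`, because `a_μ(d[7]) = 1` is a kernel value and a kernel certificate gives
`0 < mult_μ ≤ a_μ`. [cite: DorflerIkenmeyerPanova2020, Prop. 5.1 (arXiv p. 12) and Prop. 7.1 (arXiv p. 16)] -/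
theorem hadamardHowe_chow47_le_five_guard :
    coordRingMultiplicity ℂ (chowSet ℂ 4 7) 7 (rowDual ![10, 10, 1, 0]) =
        plethysmCoeff ℂ (Fin 4) 7 (rowDual ![10, 10, 1, 0]) ∧
      coordRingMultiplicity ℂ (chowSet ℂ 4 7) 7 (rowDual ![10, 6, 6, 6]) =
        plethysmCoeff ℂ (Fin 4) 7 (rowDual ![10, 6, 6, 6]) := by
  have h1 : plethysmCoeff ℂ (Fin 4) 7 (rowDual ![10, 10, 1, 0]) = 1 := by
    exact_mod_cast plethysmCoeff_fin_four_rowDual_10_10_1_0_seven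
  have h2 : plethysmCoeff ℂ (Fin 4) 7 (rowDual ![10, 6, 6, 6]) = 1 := by
    exact_mod_cast plethysmCoeff_fin_four_rowDual_10_6_6_6_seven
  refine ⟨le_antisymm (coordRingMultiplicity_le_plethysmCoeff _ _ _) ?_,
    le_antisymm (coordRingMultiplicity_le_plethysmCoeff _ _ _) ?_⟩
  · rw [h1]
    exact TableauEval.coordRingMultiplicity_chowSet_rowDual_10_10_1_0_seven_pos
  · rw [h2]
    exact TableauEval.coordRingMultiplicity_chowSet_rowDual_10_6_6_6_seven_pos

/-- **DIP 2020 Prop. 5.1, conjunct 2, for the generators of inner degree `d ≤ 5` — conditional on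
`hadamardHowe_chow47_le_five`**: for `μ ∈ X` with `|μ| ≤ 35`, `0 < mult_μ(ℂ[Ch_4^7])`, because
`mult_μ = a_μ(d[7])` (the fact) and `a_μ(d[7]) > 0` is a kernel value (`dipGenerators47_plethysmCoeff_pos`).
[cite: DorflerIkenmeyerPanova2020, Prop. 5.1 (arXiv p. 12) and Prop. 7.1 (arXiv p. 16)] -/
theorem coordRingMultiplicity_chowSet47_pos_of_sum_le (h : hadamardHowe_chow47_le_five)
    {μ : Fin 4 → ℕ} (hμ : μ ∈ dipGenerators47) (h35 : (∑ i, μ i) ≤ 35) :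
    0 < coordRingMultiplicity ℂ (chowSet ℂ 4 7) 7 (rowDual μ) := by
  rw [h μ h35]
  exact dipGenerators47_plethysmCoeff_pos μ hμ

/-- The same over DIP's printed rows: for every row `t = (a,b,c,e)` of `X` with `a+b+c+e ≤ 35`
(the `395` rows of inner degree `≤ 5`), `0 < mult_{(a,b,c,e)}(ℂ[Ch_4^7])`, conditionally on
`hadamardHowe_chow47_le_five`. [cite: DorflerIkenmeyerPanova2020, Prop. 5.1 (arXiv p. 12) and Prop. 7.1 (arXiv p. 16)] -/
theorem coordRingMultiplicity_chowSet47_quadRow_pos_of_sum_le (h : hadamardHowe_chow47_le_five)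
    {t : ℕ × ℕ × ℕ × ℕ} (ht : t ∈ dipGeneratorRows47) (h35 : t.1 + t.2.1 + t.2.2.1 + t.2.2.2 ≤ 35) :
    0 < coordRingMultiplicity ℂ (chowSet ℂ 4 7) 7 (rowDual (quadRow t)) := by
  refine coordRingMultiplicity_chowSet47_pos_of_sum_le h (quadRow_mem_dipGenerators47 ht) ?_
  simpa [quadRow, Fin.sum_univ_four, add_assoc] using h35

/-- **What remains of conjunct 2 given the fact**: if, in addition, every row of `X` of inner degree
`d ≥ 6` (`|μ| ≥ 42`; `553` rows) has positive multiplicity, then conjunct 2 of `DIP20_prop_5_1` holds.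
[cite: DorflerIkenmeyerPanova2020, Prop. 5.1 (arXiv p. 12)] -/
theorem DIP20_prop_5_1_right_of_hadamardHowe_of_ge_six (h : hadamardHowe_chow47_le_five)
    (h6 : ∀ μ ∈ dipGenerators47, 36 ≤ (∑ i, μ i) →
      0 < coordRingMultiplicity ℂ (chowSet ℂ 4 7) 7 (rowDual μ)) :
    ∀ μ ∈ dipGenerators47, 0 < coordRingMultiplicity ℂ (chowSet ℂ 4 7) 7 (rowDual μ) := by
  intro μ hμ
  by_cases h35 : (∑ i, μ i) ≤ 35
  · exact coordRingMultiplicity_chowSet47_pos_of_sum_le h hμ h35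
  · exact h6 μ hμ (by omega)

end Literature.Computability.AlgebraicComplexity
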